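import Mathlib

/-!
# T4FirstOrderSize — NE1′ first-order size bookkeeping (cell `pub-balaban`, T4-DAG v3 §5 row T4-O3.E-i′; EST shape)

HONEST FRAMING (cell `pub-balaban`, T4-DAG PAGE 1).  The cell's T4 target is the existence AND uniqueness of the
continuum limit of Bałaban's unit-scale averaged loop expectations on a finite torus — a constructive-QFT statement
strictly beyond ultraviolet stability ([Balaban1989LargeFieldII] Thm 1 p. 355); it is NOT the Yang–Mills mass gap and
NOT the Clay problem.  This module types the SIZE MECHANISM the cell's referee record `t4/T4-REF-O3.md` (V5 (i)(ii),
"NE1′") REQUIRES of the observable-attached exponent terms ("D-terms") of the cell's dressed renormalization operation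
— a requirement of the CELL'S OWN construction, about terms that do not occur in CMP 109/116/122 — as `Prop` shapes
over abstract finite sums, plus the elementary inequalities that make the bookkeeping kernel-checked.  It asserts
NOTHING about Bałaban's renormalization-group objects and proves NO estimate of the series: every analytic input
(the conditional-mean Lipschitz bound, the flatness of exterior configurations on the analyticity domains, the
per-bond amplitude of the linearised dressing) enters as a HYPOTHESIS on abstract data.  Value = typed estimate shape
+ kernel bookkeeping of an implication ⇐ named inputs; NOT summit progress.

Printed context (verbatim, page-cited, read on the rendered pages; the manuscripts under audit are quoted for
CONTEXT only — no disputed step of theirs is used anywhere below).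
* THE TWO CURRENCIES a differentiated exponent term may be charged to, [Balaban1988RG2Cluster] p. 16: "We take a
  small, positive number α₄, to be chosen later, and 1/|τ(Y)| = E₀ε₁C₁α₄⁻¹M^q exp C₂κ₁ exp(−(1 − 3δ)κd_k(Y)). (2.18)"
  … "Using (1.28) we obtain Σ_{Y∈D} |τ(Y)||V_k(Y, B)| ≤ ½ Σ_{b,b′⊂Y₀} α₄M⁻⁴ exp(−(1/16)(κ₁ − 1)M⁻¹|b₋ − b′₋|)
  |B(b)||B(b′)| + Σ_{Y∈D} α₄ exp(−δκd_k(Y)) ≤ ½O(1)α₄ Σ_{b⊂Y₀} |B(b)|² + O(1)α₄M⁻⁴|Y₀|. (2.20)" — a QUADRATIC currency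
  (½O(1)α₄ per bond, in |B(b)|²) and a CONSTANT currency (O(1)α₄M⁻⁴ per site of Y₀).
  [cite: Balaban1988RG2Cluster, (2.18)/(2.20) p. 16]
* THE INSERT whose conditional mean matters, [Balaban1989LargeFieldI] (1.100)–(1.102) p. 201: the i-th factor of the
  display (1.100) defining (ℝ′ρ_k)(V_k) contains the normalised quotient
  "δ_{G_i}(V′_k)χ(Λ_i) exp[−(1/g_k²)A(ζ_i, U_{k,X_i}(V′_kV_{Λ_i}))] / ∫dV′⌈_{Λ_i} δ_{G_i}(V′)χ(Λ_i) exp[−(1/g_k²)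
  A(ζ_i, U_{k,X_i}(V′V_{Λ_i}))]" (inside "(1/N_i) Σ_{{Ω^c_{i,j},Z_{i,j}},G_i,T_i} χ_{k,Λ_i} …", followed by the h-scale
  integral "∫dV_h⌈… χ_{h,1/2}((Ω″~_{i,h+1})^c ∩ Ω_{i,h})𝕋_h(Z_{i,h}) ∫dV′⌈_{B_i}δ_{T_i}(V′)χ′_i" and the common
  factor "exp A″_k"), "where G_i is a graph in Λ_i fixing the axial gauge, ζ_i∈C₀^∞(X_i), ζ_i changes from 0 to 1
  in a neighborhood of ∂X_i^{~−2}, and χ(Λ_i) is given by χ(Λ_i) = χ({|(1/i) log V′(b)| < M₀ε_k for b∈Λ_i}).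
  (1.101) Because of the gauge fixing terms the expressions in (1.100) are not Euclidean invariant, and we have
  introduced the averaging over families of graphs, such that the averaged expressions are invariant." … "The above
  operation has the fundamental normalization property ∫dV_k(ℝ′ρ_k)(V_k) = ∫dV_kρ_k(V_k). (1.102)"
  [cite: Balaban1989LargeFieldI, (1.100)–(1.102) p. 201]
* THE BACKGROUND OF THE INSERT, [Balaban1989LargeFieldI] Prop. 1 p. 194: "For a configuration V_k⌈_{Z∩Λ^c},
  satisfying the regularity condition |∂V_k − 1| < ε on the domain Z ∩ Λ^c, for ε > 0 sufficiently small, there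
  exists exactly one critical orbit of the function (1.77). An element of the orbit is a minimum of the function,
  and is denoted by V_Λ = V_Λ(V_k⌈_{Z∩Λ^c}). It satisfies the regularity condition |V_Λ(∂p′) − 1| < B₅M⁵ε for p′∈Λ.
  (1.78) The orbit-valued function V_Λ(V_k⌈_{Z∩Λ^c}) has an analytic extension for G^c-valued configurations
  𝕍_k = V′_kV_k = exp iB′V_k satisfying the same regularity condition as V_k, with B′∈g^c and small, e.g.,
  |B′| < ε."; and the fluctuation field of the h-scale integral, p. 196: "Using the Faddeev–Popov procedure we
  introduce the gauge fixing δ-function δ_{T₀}(V′) in the integral (1.76). The regularity conditions for V″, V₀, and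
  the gauge fixing for V′ introduce restrictions on this field. We can prove that it satisfies |V′ − 1| <
  O(1)M²NR_k⁴ε_k on B₀. We introduce stronger restrictions on the fluctuation field by the decomposition of unity
  1 = χ′ + (1 − χ′), where χ′ = χ({|B′(b)| < δ′_k for b∈B₀}), (1.82) and V′ = exp iB′."
  [cite: Balaban1989LargeFieldI, Prop. 1 (1.78) p. 194; (1.82) p. 196]
* THE FLATNESS the analyticity domains print, [Balaban1987RG1] p. 262: "A G^c-valued gauge transformation u acts on
  pairs (U, J) in the following way (U, J)^u = (U^u, R(u)J) = (u₋Uu₊⁻¹, R(u₋)J), (1.10)" … "The space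
  U^c_j(X, α₀, α₁, γ₀) is a union of orbits [(U, J)] determined by configurations U, J satisfying the four conditions
  written below. (i) U = U′U, U has values in the group G, |∂U − 1| < α₀ξ² on X, (1.11)" … "(iii) The
  configurations U, J satisfy the bounds |∂U − 1| < α₀ξ², |J| < γ₀ on X. (1.14)".
  [cite: Balaban1987RG1, (1.10)/(1.11)/(1.14) p. 262]

How the cell uses them (T4-REF-O3 V4/V5 — the cell's referee ANALYSIS, not in print; nothing below is claimed to
hold for the series).  A D-term born at (j, Λ_i) is booked HIERARCHICALLY (V4): a function of the scale-j fluctuation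
field on the small domain X_i^L times an analytic function of the block-field tower above it.  Its part LINEAR in the
fluctuation field, `t · Σ_b ⟪a b, B b⟫` (per-bond coefficient `‖a b‖ ≲ |μ| g_j θ₁^{K−j}`, V5 (i)), is charged to
(2.20)'s quadratic currency by Cauchy–Schwarz / Young at the CONSTANT cost `Σ_b (t‖a b‖)²/(2η)` with `η ≤ O(1)α₄` —
its SQUARE, second order in `θ₁^{K−j}` although its sup is first order (§1–§2 below).  What the scale-j integration
leaves of it is `t · Σ_b ⟪a b, m b⟫` with `m` the CONDITIONAL MEAN of the fluctuation given the exterior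
configuration (§3): `m = 0` at a flat (pure-gauge) exterior by global colour symmetry (the kernel symmetry lemma is
row T4-O3.E-i′.K, module `T4AdInvariant`, pv20-g3 lineage — consumed here ONLY as the hypothesis `MeanVanishes`),
and `‖m u b‖ ≤ Lip · dev(u)` away from flat with `dev` the gauge-invariant deviation printed by (1.11)/(1.14)
(V5 (ii); consumed as the hypothesis `CondMeanSuppression`).  §4 assembles the resulting BIRTH SIZE per tube M-cube in
the shape `|s j| ≤ C · w j · ρ^{K−j}` (`w j = g_j² R_j²`, `ρ = θ₁φ`; and the absorbed cost with `w j = g_j²`,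
`ρ = θ₁²`) that the tube budget (TOB-k) of row T4-O3b.B (`T4TubeBudget`, pv21-g3 lineage) consumes; the honest
M-power of the first-order size is M⁶ (4M⁴ bonds per M-cube × (100MR_j)² from the component diameter), immaterial for
K-uniformity.  Located obligations NOT typed here (record `t4/T4-EST-O3Ei1.md`): (α) which factors of the (1.100)
insert the colour-symmetry argument must survive; (β) where [Balaban1989LargeFieldII] places the insert's exterior
configuration inside an analyticity domain of the (1.11)/(1.14) type; (γ) the diagonal second-order (Hessian-trace)
part of the first-order-in-μ birth size and the re-linearisation at later scales.

Interfaces (cell coordination, T4-DAG v3 §5).  SUPPLIERS of the hypotheses: `MeanVanishes` at a flat exterior ←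
row T4-O3.E-i′.K (`T4AdInvariant`, symmetry: Ad-invariant vectors of 𝔤 vanish; law invariance of the insert);
the amplitude rate `A j ≤ c_A g_j θ₁^{K−j}` ← rows T4-O3c.R1 / T4-O3c.E2 (per-bond first-derivative rate θ₁ of
`W_C ∘ avg^n`; `T4AvgSensitivity.LoopOscBound` is the sup version); the deviation `dev ≤ α₀(100MR_j)²φ^{K−j}` and the
Lipschitz constant ← located obligations (β) of `t4/T4-EST-O3Ei1.md`.  CONSUMERS: the sizes `FirstOrderSize` /
`AbsorbedCostSize` (shape `|s j| ≤ C·w j·ρ^{K−j}`) → row T4-O3b.B (`T4TubeBudget`, budget (TOB-k): K-uniform iff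
`L⁴ρ ≤ 1` and the weights are summable against the component density); `LinearAbsorbed` / `InCurrency` → the format
row T4-O3.E-iii-a (exponent-term class with a (2.20)-currency slot).

What is proved (all [folklore]: Young's inequality, Cauchy–Schwarz on a real inner-product space, linearity of the
Bochner integral, monotone real arithmetic).  No `sorry`; standard axioms only.
-/

namespace Literature.MathematicalPhysics.QuantumFieldTheory.Balaban1983to89.T4FirstOrderSize

open Finset MeasureTheory
open scoped BigOperators InnerProductSpace

/-! ## §1  One bond: Young / Cauchy–Schwarz absorption -/

/-- Young's inequality with a parameter: `x·y ≤ x²/(2η) + (η/2)·y²` for `η > 0` (it is `(x − ηy)² ≥ 0`). [folklore] -/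
theorem mul_le_sq_div_add_sq (x y : ℝ) {η : ℝ} (hη : 0 < η) : x * y ≤ x ^ 2 / (2 * η) + η / 2 * y ^ 2 := by
  rw [← sub_nonneg]
  have h : x ^ 2 / (2 * η) + η / 2 * y ^ 2 - x * y = (x - η * y) ^ 2 / (2 * η) := by
    field_simp
    ring
  rw [h]
  positivity

/-- ONE-BOND ABSORPTION: a scalar multiple of a real inner product is charged to the quadratic currency `(η/2)‖B‖²`
at the constant cost `(t‖a‖)²/(2η)` — the SQUARE of its amplitude (Cauchy–Schwarz then Young). [folklore] -/
theorem abs_mul_inner_le {E : Type*} [NormedAddCommGroup E] [InnerProductSpace ℝ E] (t : ℝ) (a B : E) {η : ℝ}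
    (hη : 0 < η) : |t * ⟪a, B⟫_ℝ| ≤ (t * ‖a‖) ^ 2 / (2 * η) + η / 2 * ‖B‖ ^ 2 := by
  calc |(t * ⟪a, B⟫_ℝ)| = |t| * |(⟪a, B⟫_ℝ)| := abs_mul _ _
    _ ≤ |t| * (‖a‖ * ‖B‖) := mul_le_mul_of_nonneg_left (abs_real_inner_le_norm a B) (abs_nonneg t)
    _ = (|t| * ‖a‖) * ‖B‖ := by ring
    _ ≤ (|t| * ‖a‖) ^ 2 / (2 * η) + η / 2 * ‖B‖ ^ 2 := mul_le_sq_div_add_sq _ _ hη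
    _ = (t * ‖a‖) ^ 2 / (2 * η) + η / 2 * ‖B‖ ^ 2 := by rw [mul_pow, sq_abs, mul_pow]

/-! ## §2  The linear part of a D-term and the (2.20) currencies (`LinearAbsorbed`) -/

section Linear

variable {β : Type*} {E : Type*} [NormedAddCommGroup E] [InnerProductSpace ℝ E]

/-- The FLUCTUATION-LINEAR part of an exponent term, over a finite set `S` of bonds: `t · Σ_{b∈S} ⟪a b, B b⟫`, with
`a` the (real, Lie-algebra-valued) coefficient field of the linearised dressing and `t` a scalar bookkeeping weight
(`t = |τ(Y)|` when charging to (2.20); `t = |μ|·|τ(Y)|` for a complex loop parameter μ pulled out of `a`).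
[cite: Balaban1988RG2Cluster, (2.20) p. 16] -/
def linTerm (t : ℝ) (S : Finset β) (a B : β → E) : ℝ := t * ∑ b ∈ S, ⟪a b, B b⟫_ℝ

/-- HYPOTHESIS / TARGET SHAPE — "charged to (2.20)'s two currencies": a functional `v` of the fluctuation field on the
bond set `S` is IN CURRENCY with quadratic coefficient `q` (↔ the printed ½O(1)α₄, so `q ≤ O(1)α₄`) and constant
`c` PER BOND (↔ the printed O(1)α₄M⁻⁴ per site; a site of a d = 4 lattice carries 4 positively oriented bonds) if
`|v B| ≤ (q/2)·Σ_{b∈S}‖B b‖² + c·|S|` for every field `B`.  A shape only; nothing printed is asserted.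
[cite: Balaban1988RG2Cluster, (2.20) p. 16] -/
def InCurrency (S : Finset β) (q c : ℝ) (v : (β → E) → ℝ) : Prop :=
  ∀ B : β → E, |v B| ≤ q / 2 * ∑ b ∈ S, ‖B b‖ ^ 2 + c * (S.card : ℝ)

omit [InnerProductSpace ℝ E] in
/-- `InCurrency` is monotone in both currencies. [folklore] -/
theorem InCurrency.mono {S : Finset β} {q q' c c' : ℝ} {v : (β → E) → ℝ} (h : InCurrency S q c v) (hq : q ≤ q')
    (hc : c ≤ c') : InCurrency S q' c' v := by
  intro B
  refine (h B).trans ?_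
  have hs : 0 ≤ ∑ b ∈ S, ‖B b‖ ^ 2 := Finset.sum_nonneg fun b _ => sq_nonneg _
  have hcard : (0 : ℝ) ≤ S.card := Nat.cast_nonneg _
  nlinarith [mul_le_mul_of_nonneg_right hq hs, mul_le_mul_of_nonneg_right hc hcard]

/-- BOND-BY-BOND ABSORPTION of the linear part: `|t·Σ⟪a b, B b⟫| ≤ Σ_b (t‖a b‖)²/(2η) + (η/2)·Σ_b ‖B b‖²`.
[folklore] -/
theorem abs_linTerm_le (t : ℝ) (S : Finset β) (a B : β → E) {η : ℝ} (hη : 0 < η) :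
    |linTerm t S a B| ≤ ∑ b ∈ S, (t * ‖a b‖) ^ 2 / (2 * η) + η / 2 * ∑ b ∈ S, ‖B b‖ ^ 2 := by
  unfold linTerm
  rw [Finset.mul_sum]
  calc |(∑ b ∈ S, t * ⟪a b, B b⟫_ℝ)| ≤ ∑ b ∈ S, |(t * ⟪a b, B b⟫_ℝ)| := Finset.abs_sum_le_sum_abs _ _
    _ ≤ ∑ b ∈ S, ((t * ‖a b‖) ^ 2 / (2 * η) + η / 2 * ‖B b‖ ^ 2) :=
        Finset.sum_le_sum fun b _ => abs_mul_inner_le t (a b) (B b) hη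
    _ = ∑ b ∈ S, (t * ‖a b‖) ^ 2 / (2 * η) + η / 2 * ∑ b ∈ S, ‖B b‖ ^ 2 := by
        rw [Finset.sum_add_distrib, Finset.mul_sum]

/-- TARGET SHAPE `LinearAbsorbed` (T4-REF-O3 V5 (i), row T4-O3.E-i′ (a)): the linear part with weight `t` and
coefficients `a` on `S` is charged to (2.20)'s currencies with quadratic coefficient `η` and constant cost `cost`
per bond.  [cite: Balaban1988RG2Cluster, (2.20) p. 16] -/
def LinearAbsorbed (S : Finset β) (a : β → E) (t η cost : ℝ) : Prop := InCurrency S η cost (linTerm t S a)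

/-- THE ABSORPTION (V5 (i) made kernel-checked): a per-bond amplitude bound `‖a b‖ ≤ A` gives `LinearAbsorbed` with
quadratic coefficient `η` (any `η > 0`; the budget wants `η ≤ O(1)α₄`) at the constant cost `(tA)²/(2η)` PER BOND —
SECOND ORDER in the amplitude, although the sup of the linear part over `‖B b‖ ≤ r` is first order (`|t|·|S|·A·r`).
[folklore] -/
theorem linearAbsorbed_of_amplitude {S : Finset β} {a : β → E} {A : ℝ} (hA : ∀ b ∈ S, ‖a b‖ ≤ A) (t : ℝ) {η : ℝ}
    (hη : 0 < η) : LinearAbsorbed S a t η ((t * A) ^ 2 / (2 * η)) := by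
  intro B
  refine (abs_linTerm_le t S a B hη).trans ?_
  have hb : ∀ b ∈ S, (t * ‖a b‖) ^ 2 / (2 * η) ≤ (t * A) ^ 2 / (2 * η) := fun b hb => by
    apply div_le_div_of_nonneg_right _ (by positivity)
    rw [mul_pow, mul_pow]
    exact mul_le_mul_of_nonneg_left (pow_le_pow_left₀ (norm_nonneg _) (hA b hb) 2) (sq_nonneg t)
  calc ∑ b ∈ S, (t * ‖a b‖) ^ 2 / (2 * η) + η / 2 * ∑ b ∈ S, ‖B b‖ ^ 2
      ≤ ∑ b ∈ S, (t * A) ^ 2 / (2 * η) + η / 2 * ∑ b ∈ S, ‖B b‖ ^ 2 :=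
        add_le_add_left (Finset.sum_le_sum hb) _
    _ = η / 2 * ∑ b ∈ S, ‖B b‖ ^ 2 + (t * A) ^ 2 / (2 * η) * (S.card : ℝ) := by
        rw [Finset.sum_const, nsmul_eq_mul]
        ring

/-- The first-order sup that (2.20) does NOT charge: `|linTerm t S a B| ≤ |t|·(|S|·A)·r` when `‖a b‖ ≤ A` and
`‖B b‖ ≤ r` on `S` (the "oscillation" size of the linear part — first order in `A`; contrast
`linearAbsorbed_of_amplitude`). [folklore] -/
theorem abs_linTerm_le_sup {S : Finset β} {a B : β → E} {A r : ℝ} (hA : ∀ b ∈ S, ‖a b‖ ≤ A)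
    (hr : ∀ b ∈ S, ‖B b‖ ≤ r) (t : ℝ) : |linTerm t S a B| ≤ |t| * ((S.card : ℝ) * A * r) := by
  unfold linTerm
  rw [abs_mul]
  refine mul_le_mul_of_nonneg_left ?_ (abs_nonneg t)
  calc |(∑ b ∈ S, ⟪a b, B b⟫_ℝ)| ≤ ∑ b ∈ S, |(⟪a b, B b⟫_ℝ)| := Finset.abs_sum_le_sum_abs _ _
    _ ≤ ∑ b ∈ S, A * r := Finset.sum_le_sum fun b hb =>
        (abs_real_inner_le_norm _ _).trans
          (mul_le_mul (hA b hb) (hr b hb) (norm_nonneg _) ((norm_nonneg _).trans (hA b hb)))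
    _ = (S.card : ℝ) * A * r := by rw [Finset.sum_const, nsmul_eq_mul]; ring

end Linear

/-! ## §3  Conditional mean of the fluctuation and the first-order remainder (`CondMeanSuppression`) -/

section CondMean

variable {β : Type*} {E : Type*} [NormedAddCommGroup E] [InnerProductSpace ℝ E]
variable {Ω : Type*} [MeasurableSpace Ω]

/-- The CONDITIONAL MEAN FIELD of the fluctuation `B : Ω → (bonds → E)` under a law `P` on the fluctuation space (the
normalised insert of (1.100) at a fixed exterior configuration): `m b = ∫ B(ω) b dP(ω)`.
[cite: Balaban1989LargeFieldI, (1.100) p. 201] -/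
noncomputable def meanField (P : Measure Ω) (B : Ω → β → E) : β → E := fun b => ∫ ω, B ω b ∂P

/-- FIRST-ORDER REMAINDER = LINEAR PART AT THE CONDITIONAL MEAN: integrating the linear part against the insert law
leaves `t·Σ⟪a b, m b⟫` (linearity of the Bochner integral; integrability of each `B · b` is the honest binder).
[folklore] -/
theorem integral_linTerm [CompleteSpace E] (P : Measure Ω) (t : ℝ) (S : Finset β) (a : β → E) (B : Ω → β → E)
    (hB : ∀ b ∈ S, Integrable (fun ω => B ω b) P) :
    ∫ ω, linTerm t S a (B ω) ∂P = linTerm t S a (meanField P B) := by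
  unfold linTerm meanField
  rw [integral_const_mul]
  congr 1
  rw [integral_finsetSum S (fun b hb => (hB b hb).const_inner (a b))]
  exact Finset.sum_congr rfl fun b hb => integral_inner (hB b hb) (a b)

/-- HYPOTHESIS SHAPE — the mean field VANISHES on `S` (at a flat exterior configuration this is the colour-symmetry
lemma of row T4-O3.E-i′.K: an Ad-invariant vector of a semisimple Lie algebra is 0; consumed here as a hypothesis).
[cite: Balaban1989LargeFieldI, (1.101) p. 201] -/
def MeanVanishes (S : Finset β) (m : β → E) : Prop := ∀ b ∈ S, m b = 0

/-- At a configuration where the mean field vanishes the first-order remainder is exactly 0. [folklore] -/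
theorem linTerm_eq_zero_of_meanVanishes {S : Finset β} {m : β → E} (h : MeanVanishes S m) (t : ℝ) (a : β → E) :
    linTerm t S a m = 0 := by
  unfold linTerm
  rw [Finset.sum_eq_zero fun b hb => by rw [h b hb, inner_zero_right], mul_zero]

variable {𝒰 : Type*}

/-- HYPOTHESIS SHAPE — LIPSCHITZ DEPENDENCE of the mean field on the exterior configuration `u ∈ dom` relative to a
reference `u₀`: `‖m u b − m u₀ b‖ ≤ lip · dev u` on `S`, with `dev u ≥ 0` the (gauge-invariant) deviation of `u`
from `u₀` (T4-REF-O3 V5 (ii): analytic dependence + Cauchy; NOT PRINTED, consumed as a hypothesis).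
[cite: Balaban1989LargeFieldI, Prop. 1 p. 194] -/
def MeanLipschitz (dom : Set 𝒰) (m : 𝒰 → β → E) (S : Finset β) (u₀ : 𝒰) (dev : 𝒰 → ℝ) (lip : ℝ) : Prop :=
  ∀ u ∈ dom, ∀ b ∈ S, ‖m u b - m u₀ b‖ ≤ lip * dev u

/-- HYPOTHESIS / TARGET SHAPE `CondMeanSuppression` (T4-REF-O3 V5 (ii), row T4-O3.E-i′ (b)): on the domain `dom` of
exterior configurations the conditional mean field is bounded by `lip × (deviation from flat)`:
`‖m u b‖ ≤ lip · dev u` for `b ∈ S`.  With `dev u ≲ α₀(100MR_j)²φ^{K−j}` read from the (1.11)/(1.14) flatness of the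
analyticity domains this is the CONDITIONAL-MEAN SUPPRESSION; nothing printed is asserted.
[cite: Balaban1987RG1, (1.11)/(1.14) p. 262] -/
def CondMeanSuppression (dom : Set 𝒰) (m : 𝒰 → β → E) (S : Finset β) (dev : 𝒰 → ℝ) (lip : ℝ) : Prop :=
  ∀ u ∈ dom, ∀ b ∈ S, ‖m u b‖ ≤ lip * dev u

omit [InnerProductSpace ℝ E] [MeasurableSpace Ω] in
/-- THE PRINTED-STRUCTURE IMPLICATION of V5 (ii): mean zero at the flat reference `u₀` + Lipschitz dependence on the
exterior configuration ⇒ conditional-mean suppression. [folklore] -/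
theorem condMeanSuppression_of_flat {dom : Set 𝒰} {m : 𝒰 → β → E} {S : Finset β} {u₀ : 𝒰} {dev : 𝒰 → ℝ}
    {lip : ℝ} (h0 : MeanVanishes S (m u₀)) (hL : MeanLipschitz dom m S u₀ dev lip) :
    CondMeanSuppression dom m S dev lip := by
  intro u hu b hb
  have h := hL u hu b hb
  rwa [h0 b hb, sub_zero] at h

/-- FIRST-ORDER REMAINDER BOUND: under `CondMeanSuppression`, with per-bond amplitude `‖a b‖ ≤ A` on `S`,
`|t·Σ⟪a b, m u b⟫| ≤ |t|·(|S|·A)·(lip·dev u)` — FIRST order in the amplitude times the flatness factor.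
[folklore] -/
theorem abs_linTerm_mean_le {dom : Set 𝒰} {m : 𝒰 → β → E} {S : Finset β} {dev : 𝒰 → ℝ} {lip : ℝ}
    (h : CondMeanSuppression dom m S dev lip) {u : 𝒰} (hu : u ∈ dom) {a : β → E} {A : ℝ}
    (hA : ∀ b ∈ S, ‖a b‖ ≤ A) (t : ℝ) : |linTerm t S a (m u)| ≤ |t| * ((S.card : ℝ) * A * (lip * dev u)) :=
  abs_linTerm_le_sup hA (fun b hb => h u hu b hb) t

/-- The remainder vanishes at the flat reference itself (exact, no perturbation theory). [folklore] -/
theorem linTerm_mean_flat_eq_zero {m : 𝒰 → β → E} {S : Finset β} {u₀ : 𝒰} (h0 : MeanVanishes S (m u₀)) (t : ℝ)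
    (a : β → E) : linTerm t S a (m u₀) = 0 :=
  linTerm_eq_zero_of_meanVanishes h0 t a

end CondMean

/-! ## §4  NE1′ birth sizes per tube M-cube in the tube-budget shape (`FirstOrderSize`) -/

section Sizes

/-- CONSUMER SHAPE — sizes indexed by the birth scale `j ≤ K` in the form the tube budget (TOB-k) of row T4-O3b.B
consumes: `|s j| ≤ C · w j · ρ^{K−j}` with a scale weight `w` (summability of `Σ_j g_j^{κ₀} w j` is the budget's
business) and a per-level rate `ρ` (the budget needs `L⁴ρ ≤ 1`).  T4-REF-O3 V5 (iv); NOT PRINTED.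
[cite: Balaban1988RG2Cluster, (2.20) p. 16] -/
def SizeShape (K : ℕ) (s : ℕ → ℝ) (C : ℝ) (w : ℕ → ℝ) (ρ : ℝ) : Prop :=
  ∀ j, j ≤ K → |s j| ≤ C * w j * ρ ^ (K - j)

/-- `SizeShape` is monotone in the constant for non-negative weights and rate. [folklore] -/
theorem SizeShape.mono {K : ℕ} {s : ℕ → ℝ} {C C' : ℝ} {w : ℕ → ℝ} {ρ : ℝ} (h : SizeShape K s C w ρ) (hC : C ≤ C')
    (hw : ∀ j, 0 ≤ w j) (hρ : 0 ≤ ρ) : SizeShape K s C' w ρ := fun j hj =>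
  (h j hj).trans (mul_le_mul_of_nonneg_right (mul_le_mul_of_nonneg_right hC (hw j)) (pow_nonneg hρ _))

/-- THE NE1′ PARAMETRISATION, exact algebra (T4-REF-O3 V5 (ii) with the M-power made honest): (bonds per M-cube
`4M⁴`) × (weight `|t|` × amplitude `c_A g_j θ₁^{K−j}` per bond) × (Lipschitz constant `c_M g_j`) × (deviation
`α₀(100MR_j)²φ^{K−j}`) `= (4·100²·c_A c_M α₀)·|t|·M⁶·(g_j²R_j²)·(θ₁φ)^{K−j}`. [folklore] -/
theorem firstOrder_product_eq (t cA cM α₀ M φ θ₁ : ℝ) (g R : ℕ → ℝ) (K j : ℕ) :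
    (4 * M ^ 4) * (|t| * (cA * g j * θ₁ ^ (K - j))) * ((cM * g j) * (α₀ * (100 * M * R j) ^ 2 * φ ^ (K - j)))
      = (4 * 100 ^ 2 * cA * cM * α₀) * |t| * M ^ 6 * (g j ^ 2 * R j ^ 2) * (θ₁ * φ) ^ (K - j) := by
  rw [mul_pow θ₁ φ]
  ring

/-- TARGET SHAPE `FirstOrderSize` MET AT BIRTH (T4-REF-O3 V5 (ii) ⇐ its named inputs, kernel-checked bookkeeping):
if for every birth scale `j ≤ K` the first-order remainder per tube M-cube is bounded by (number of bonds `N ≤ 4M⁴`)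
× (`|t|` × amplitude `A j ≤ c_A g_j θ₁^{K−j}`) × (Lipschitz constant `lip j ≤ c_M g_j`) × (deviation
`dev j ≤ α₀(100MR_j)²φ^{K−j}`) — the output of `abs_linTerm_mean_le` — then the sizes have the tube-budget shape with
weight `g_j²R_j²`, rate `θ₁φ` and constant `(4·100²·c_A c_M α₀)|t|M⁶`.  Every factor is a hypothesis; nothing
printed is asserted. [folklore] -/
theorem sizeShape_firstOrder {K : ℕ} {s : ℕ → ℝ} {N t cA cM α₀ M φ θ₁ : ℝ} {A lip dev g R : ℕ → ℝ}
    (hs : ∀ j, j ≤ K → |s j| ≤ N * (|t| * A j) * (lip j * dev j))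
    (hN : N ≤ 4 * M ^ 4) (hA : ∀ j, A j ≤ cA * g j * θ₁ ^ (K - j)) (hlip : ∀ j, lip j ≤ cM * g j)
    (hdev : ∀ j, dev j ≤ α₀ * (100 * M * R j) ^ 2 * φ ^ (K - j))
    (hN0 : 0 ≤ N) (hA0 : ∀ j, 0 ≤ A j) (hlip0 : ∀ j, 0 ≤ lip j) (hdev0 : ∀ j, 0 ≤ dev j)
    (hcA : 0 ≤ cA) (hcM : 0 ≤ cM) (hg : ∀ j, 0 ≤ g j) (hθ : 0 ≤ θ₁) :
    SizeShape K s ((4 * 100 ^ 2 * cA * cM * α₀) * |t| * M ^ 6) (fun j => g j ^ 2 * R j ^ 2) (θ₁ * φ) := by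
  intro j hj
  refine (hs j hj).trans ?_
  rw [← firstOrder_product_eq t cA cM α₀ M φ θ₁ g R K j]
  have h1 : |t| * A j ≤ |t| * (cA * g j * θ₁ ^ (K - j)) := mul_le_mul_of_nonneg_left (hA j) (abs_nonneg t)
  have h2 : lip j * dev j ≤ (cM * g j) * (α₀ * (100 * M * R j) ^ 2 * φ ^ (K - j)) :=
    mul_le_mul (hlip j) (hdev j) (hdev0 j) (mul_nonneg hcM (hg j))
  have h3 : 0 ≤ |t| * (cA * g j * θ₁ ^ (K - j)) :=
    mul_nonneg (abs_nonneg t) (mul_nonneg (mul_nonneg hcA (hg j)) (pow_nonneg hθ _))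
  calc N * (|t| * A j) * (lip j * dev j)
      ≤ (4 * M ^ 4) * (|t| * (cA * g j * θ₁ ^ (K - j))) * (lip j * dev j) :=
        mul_le_mul_of_nonneg_right (mul_le_mul hN h1 (mul_nonneg (abs_nonneg t) (hA0 j)) (hN0.trans hN))
          (mul_nonneg (hlip0 j) (hdev0 j))
    _ ≤ (4 * M ^ 4) * (|t| * (cA * g j * θ₁ ^ (K - j))) * ((cM * g j) * (α₀ * (100 * M * R j) ^ 2 * φ ^ (K - j))) :=
        mul_le_mul_of_nonneg_left h2 (mul_nonneg (hN0.trans hN) h3)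

/-- THE ABSORBED COST in the same shape, exact algebra: (bonds per M-cube `4M⁴`) × per-bond cost `(t·A_j)²/(2η)`
with `A_j = c_A g_j θ₁^{K−j}` `= (2c_A²t²/η)·M⁴·g_j²·(θ₁²)^{K−j}` — SECOND ORDER in `θ₁^{K−j}` (V5 (i)). [folklore] -/
theorem absorbedCost_product_eq (t cA η M θ₁ : ℝ) (g : ℕ → ℝ) (K j : ℕ) :
    (4 * M ^ 4) * ((t * (cA * g j * θ₁ ^ (K - j))) ^ 2 / (2 * η))
      = (2 * cA ^ 2 * t ^ 2 / η) * M ^ 4 * g j ^ 2 * (θ₁ ^ 2) ^ (K - j) := by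
  rw [← pow_mul, mul_comm 2 (K - j), pow_mul]
  ring

/-- TARGET SHAPE FOR THE ABSORBED COST (V5 (i) ⇐ `linearAbsorbed_of_amplitude`, kernel-checked bookkeeping): if the
constant-currency cost per tube M-cube of the born-at-j linear part is at most `N·(t·A_j)²/(2η)` with `N ≤ 4M⁴` bonds
and amplitude `A_j ≤ c_A g_j θ₁^{K−j}`, then the costs have the tube-budget shape with weight `g_j²`, rate `θ₁²` and
constant `(2c_A²t²/η)M⁴`. [folklore] -/
theorem sizeShape_absorbedCost {K : ℕ} {cost : ℕ → ℝ} {N t cA η M θ₁ : ℝ} {A g : ℕ → ℝ}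
    (hc : ∀ j, j ≤ K → |cost j| ≤ N * ((t * A j) ^ 2 / (2 * η))) (hN : N ≤ 4 * M ^ 4) (hN0 : 0 ≤ N)
    (hA : ∀ j, A j ≤ cA * g j * θ₁ ^ (K - j)) (hA0 : ∀ j, 0 ≤ A j) (hη : 0 < η) :
    SizeShape K cost ((2 * cA ^ 2 * t ^ 2 / η) * M ^ 4) (fun j => g j ^ 2) (θ₁ ^ 2) := by
  intro j hj
  refine (hc j hj).trans ?_
  have hsq : (t * A j) ^ 2 ≤ (t * (cA * g j * θ₁ ^ (K - j))) ^ 2 := by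
    rw [mul_pow, mul_pow]
    exact mul_le_mul_of_nonneg_left (pow_le_pow_left₀ (hA0 j) (hA j) 2) (sq_nonneg t)
  calc N * ((t * A j) ^ 2 / (2 * η)) ≤ (4 * M ^ 4) * ((t * (cA * g j * θ₁ ^ (K - j))) ^ 2 / (2 * η)) :=
        mul_le_mul hN (div_le_div_of_nonneg_right hsq (by positivity)) (by positivity) (hN0.trans hN)
    _ = (2 * cA ^ 2 * t ^ 2 / η) * M ^ 4 * g j ^ 2 * (θ₁ ^ 2) ^ (K - j) := absorbedCost_product_eq t cA η M θ₁ g K j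

/-- TARGET SHAPE `FirstOrderSize` (row T4-O3.E-i′ (b), T4-REF-O3 V5 (ii) "s_j^{(1)} ≲ c|μ|g_j²M⁴R_j²(θ₁φ)^{K−j}
per tube M-cube", with the M-power carried by the constant): the first-order remainder sizes have the tube-budget shape
with weight `g_j²R_j²` and rate `θ₁φ`.  A shape; NOT PRINTED, nothing asserted. [cite: Balaban1987RG1, (1.11) p. 262] -/
abbrev FirstOrderSize (K : ℕ) (s : ℕ → ℝ) (C θ₁ φ : ℝ) (g R : ℕ → ℝ) : Prop :=
  SizeShape K s C (fun j => g j ^ 2 * R j ^ 2) (θ₁ * φ)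

/-- TARGET SHAPE `AbsorbedCostSize` (row T4-O3.E-i′ (a), V5 (i)): the constant-currency costs of the absorbed linear
parts have the tube-budget shape with weight `g_j²` and rate `θ₁²`.  A shape; NOT PRINTED, nothing asserted.
[cite: Balaban1988RG2Cluster, (2.20) p. 16] -/
abbrev AbsorbedCostSize (K : ℕ) (cost : ℕ → ℝ) (C θ₁ : ℝ) (g : ℕ → ℝ) : Prop :=
  SizeShape K cost C (fun j => g j ^ 2) (θ₁ ^ 2)

/-- `FirstOrderSize` at birth from its four named inputs (restatement of `sizeShape_firstOrder`). [folklore] -/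
theorem firstOrderSize_birth {K : ℕ} {s : ℕ → ℝ} {N t cA cM α₀ M φ θ₁ : ℝ} {A lip dev g R : ℕ → ℝ}
    (hs : ∀ j, j ≤ K → |s j| ≤ N * (|t| * A j) * (lip j * dev j))
    (hN : N ≤ 4 * M ^ 4) (hA : ∀ j, A j ≤ cA * g j * θ₁ ^ (K - j)) (hlip : ∀ j, lip j ≤ cM * g j)
    (hdev : ∀ j, dev j ≤ α₀ * (100 * M * R j) ^ 2 * φ ^ (K - j))
    (hN0 : 0 ≤ N) (hA0 : ∀ j, 0 ≤ A j) (hlip0 : ∀ j, 0 ≤ lip j) (hdev0 : ∀ j, 0 ≤ dev j)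
    (hcA : 0 ≤ cA) (hcM : 0 ≤ cM) (hg : ∀ j, 0 ≤ g j) (hθ : 0 ≤ θ₁) :
    FirstOrderSize K s ((4 * 100 ^ 2 * cA * cM * α₀) * |t| * M ^ 6) θ₁ φ g R :=
  sizeShape_firstOrder hs hN hA hlip hdev hN0 hA0 hlip0 hdev0 hcA hcM hg hθ

/-- `AbsorbedCostSize` from the amplitude bound (restatement of `sizeShape_absorbedCost`). [folklore] -/
theorem absorbedCostSize_birth {K : ℕ} {cost : ℕ → ℝ} {N t cA η M θ₁ : ℝ} {A g : ℕ → ℝ}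
    (hc : ∀ j, j ≤ K → |cost j| ≤ N * ((t * A j) ^ 2 / (2 * η))) (hN : N ≤ 4 * M ^ 4) (hN0 : 0 ≤ N)
    (hA : ∀ j, A j ≤ cA * g j * θ₁ ^ (K - j)) (hA0 : ∀ j, 0 ≤ A j) (hη : 0 < η) :
    AbsorbedCostSize K cost ((2 * cA ^ 2 * t ^ 2 / η) * M ^ 4) θ₁ g :=
  sizeShape_absorbedCost hc hN hN0 hA hA0 hη

/-- CONTRAST (T4-REF-O3 V3 vs V5, exact algebra): the UNCHARGEABLE first-order sup of the same linear part per M-cube,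
`4M⁴ × |t| c_A g_j θ₁^{K−j} × r`, has rate `θ₁` — one power — where the absorbed cost has `θ₁²` and the suppressed
remainder `θ₁φ`. [folklore] -/
theorem supSize_product_eq (t cA r M θ₁ : ℝ) (g : ℕ → ℝ) (K j : ℕ) :
    (4 * M ^ 4) * (|t| * (cA * g j * θ₁ ^ (K - j)) * r) = (4 * cA * |t| * r) * M ^ 4 * g j * θ₁ ^ (K - j) := by
  ring

end Sizes

end Literature.MathematicalPhysics.QuantumFieldTheory.Balaban1983to89.T4FirstOrderSize
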